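import Summits.MatrixMultiplication.MatrixMultiplication.Theses.FidelityWitnesses
import Literature.Computability.AlgebraicComplexity.AlderStrassen
import Summits.MatrixMultiplication.MatrixMultiplication.Theorems.SevenEighthsLaw.Negative.SharpConstants

/-!
# Line `singlet-fraction-transfer` for crux `FidelityWitnesses.SevenEighthsLaw` (stmt-MatrixMultiplication-4959)

Lead's skeleton (prover-line-stmt-MatrixMultiplication-4959-0, 2026-08-16), RESHAPED from the planner's
`Cruxes/SevenEighthsLaw/Lines/singlet-fraction-transfer.lean` (crux-plan r1): same composition idea — exact
elimination of the output factor, then a capture bound on honest product-spanned 6-planes — with the planner's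
near/far cut (`rho0`, de Groote-conditional orthogonality law, singlet certificate) replaced by the
`E ∩ ker m` dichotomy below. Every stub is stated over tree/Mathlib vocabulary ONLY (no local `def` in a stub
signature), so a landed stub is the registered signature verbatim.

THE CRUX. `SevenEighthsLaw : ∀ S : P2 → P2 → P2 → ℂ, tensorRank S ≤ 6 → ‖∑ S·⟨2,2,2⟩‖² ≤ 7 · ∑ ‖S‖²`
(`P2 = Fin 2 × Fin 2`; slots `S a b c`, `a = (κ,ν)` the output slot, `b = (κ,μ)`, `c = (μ,ν)`,
`matMulTensor ℂ 2 2 2 a b c = [a.1 = b.1 ∧ b.2 = c.1 ∧ a.2 = c.2]`). `M(2,6) = 7`.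

THE LINE. For an orthonormal `k`-frame `e` of `X ⊗ Y = ℂ^{P2} ⊗ ℂ^{P2}` write `m(e_s) ∈ ℂ^{P2}` for the
"multiplied" vector `a ↦ Σ_μ e_s (a.1,μ) (μ,a.2)` (the matrix product `U V` when `e_s = U ⊗ V`; `m m* = 2`), and
`cap e := Σ_s ‖m(e_s)‖² = Σ_a ‖P_E T_a‖² = 2 tr(P_E Π_W)` (`E = span e`, `W = span{T_a}` the output slices of
`⟨2,2,2⟩`, `W = m*(ℂ^{P2})`, "identity in the middle").
* `stub_sliceElimination` (provable now): slices of `S` in `span e` ⇒ `|⟨S,T⟩|² ≤ ‖S‖² · cap e`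
  (orthonormal expansion + Cauchy–Schwarz). Exact: `cap e` IS the sup over `ℂ⁴ ⊗ E`.
* `stub_productFrame` (provable now): six products lie in SOME honest product-spanned 6-plane carrying an
  orthonormal basis (pad by standard products, Gram–Schmidt). Consumes the rank bound ("six products").
* `stub_capEasyRegime` (provable now): if the multiplied vectors `m(e_s)` span `≤ 3` dimensions of `ℂ^{P2}`
  then `cap e ≤ 6` — Bessel for the orthonormal `e` against `m* q_j` (`q_j` an orthonormal basis of
  `span m(e)`, `‖m* q‖² = 2‖q‖²`): `cap e = Σ_j Σ_s |⟨m* q_j, e_s⟩|² ≤ Σ_j ‖m* q_j‖² = 2·dim ≤ 6`.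
  (Equivalently `dim (E ∩ ker m) ≥ 3`.) No products needed.
* `stub_capHardRegime` (THE LOAD-BEARING stub; the lead's): if the `m(e_s)` span all of `ℂ^{P2}` (so
  `E ∩ ker m` is exactly `2`-dimensional and `E = graph(L) ⊕ (E ∩ ker m)` for a linear `L : W → ker m`), then
  `cap e ≤ 7`, i.e. `Σ_i s_i(L)²/(1 + s_i(L)²) ≥ 1/2` — equality at the Strassen-six plane (`s = (0,0,0,1)`),
  on its stabiliser-torus family and at the Bini-plus-one border planes.
* `SevenEighthsLaw_of` — the kernel-checked composition: decomposition of `S`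
  (`exists_eq_sum_triad_of_tensorRank_le`) → product frame → `cap e ≤ 7` by the dichotomy → slices of `S` lie in
  `span e` → slice elimination.

Disproof / Negative lane honoured (`Theorems/SevenEighthsLaw/Negative/SharpConstants.lean`, imported):
`_false_without_rank_bound` — the rank bound enters once, as "six products" in `stub_productFrame`;
`_false_with_rank_seven` — every stub is at exactly six; `_attained`/`_tight`/`_not_strengthened` — no stub lowers
`7`, and the hard stub is tight exactly on the planner's equality stratum (all product 6-planes through the slice
space of a maximiser `⟨2,2,2⟩ − t_{xyz}`), which lies entirely in the hard regime (`m(E) = ℂ^{P2}` there).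
Deferred from the planner's skeleton (to be re-registered if the hard-regime attack needs them):
`stub_singletIdentity` (`cap = 6 − 2·singletMass`, the partial-transpose dictionary), `stub_orthogonalityLaw`
(equality stratum, de Groote + finite check), `stub_nearStratum`/`stub_farStratum` (near/far cut at `rho0`).
-/

noncomputable section

namespace Summit.MatrixMultiplication.MatrixMultiplication.Cruxes.SevenEighthsLaw.SingletFractionTransfer

open scoped BigOperators ComplexConjugate
open Literature.Computability.AlgebraicComplexity
open Summit.MatrixMultiplication.MatrixMultiplication.Theses.FidelityWitnesses

set_option linter.unusedVariables false
set_option linter.dupNamespace false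

/-! ## Vocabulary (workfile only; every stub below is stated with these UNFOLDED) -/

/-- A slot of `⟨2,2,2⟩`: index pairs. -/
abbrev P2 : Type := Fin 2 × Fin 2

/-- The product (rank-one) vector `x ⊗ y ∈ X ⊗ Y`. -/
def prodVec (x y : P2 → ℂ) : P2 → P2 → ℂ := fun b c => x b * y c

/-- `e` is an ORTHONORMAL `k`-FRAME of `X ⊗ Y` for `⟨f, g⟩ = Σ conj f · g`. -/
def IsONFrame {k : ℕ} (e : Fin k → P2 → P2 → ℂ) : Prop :=
  ∀ s t : Fin k, (∑ b, ∑ c, conj (e s b c) * e t b c) = if s = t then 1 else 0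

/-- The frame lies inside the span of the six products `u_l ⊗ v_l`. -/
def IsProductSpanned (u v : Fin 6 → P2 → ℂ) (e : Fin 6 → P2 → P2 → ℂ) : Prop :=
  ∀ s, e s ∈ Submodule.span ℂ (Set.range fun l : Fin 6 => prodVec (u l) (v l))

/-- The CAPTURE `cap e = Σ_s ‖m(e_s)‖² = Σ_s Σ_a |⟨e_s, T_a⟩|²` (`= Σ_a ‖P_E T_a‖²` for orthonormal `e`). -/
def cap {k : ℕ} (e : Fin k → P2 → P2 → ℂ) : ℝ :=
  ∑ s, ∑ a : P2, ‖∑ m : Fin 2, e s (a.1, m) (m, a.2)‖ ^ 2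

/-! ## The stubs (signatures over tree/Mathlib vocabulary only) -/

/-- **Stub 1 — slice elimination (exact output elimination; provable now).** For an orthonormal `k`-frame `e`
of `X ⊗ Y` and any tensor `S` whose output slices `S(a,·,·)` lie in `span e`:
`|Σ S·T|² ≤ (Σ |S|²) · cap e`.
Why true: write `S(a,·,·) = Σ_s c_{a,s} e_s` with `c_{a,s} = ⟨e_s, S_a⟩` (orthonormal expansion inside
`span e`, `Submodule.mem_span_range_iff_exists_fun` + orthonormality to identify the coefficients), so
`Σ_{b,c} S(a,b,c) T(a,b,c) = Σ_s c_{a,s} τ_{s,a}` with `τ_{s,a} := Σ_m e_s (a.1,m) (m,a.2)` (the slice `T_a` is the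
`0/1` indicator of `b = (a.1,m), c = (m,a.2)`), and `Σ_{b,c} |S(a,b,c)|² = Σ_s |c_{a,s}|²` (Parseval in the span);
Cauchy–Schwarz over the index set `P2 × Fin k`. Size M. -/
theorem stub_sliceElimination {k : ℕ} (e : Fin k → (Fin 2 × Fin 2) → (Fin 2 × Fin 2) → ℂ)
    (he : ∀ s t : Fin k, (∑ b, ∑ c, conj (e s b c) * e t b c) = if s = t then 1 else 0)
    (S : (Fin 2 × Fin 2) → (Fin 2 × Fin 2) → (Fin 2 × Fin 2) → ℂ)
    (hS : ∀ a : Fin 2 × Fin 2, S a ∈ Submodule.span ℂ (Set.range e)) :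
    ‖∑ a, ∑ b, ∑ c, S a b c * matMulTensor ℂ 2 2 2 a b c‖ ^ 2
      ≤ (∑ a, ∑ b, ∑ c, ‖S a b c‖ ^ 2) *
        ∑ s, ∑ a : Fin 2 × Fin 2, ‖∑ m : Fin 2, e s (a.1, m) (m, a.2)‖ ^ 2 := by
  sorry

/-- **Stub 2 — product frames (provable now).** Any six products `u_l ⊗ v_l` lie in a 6-plane spanned by six
products `u'_l ⊗ v'_l` which carries an orthonormal basis `e` (orthonormal 6-frame inside the product span,
containing every original product in its span).
Why true: the 16 standard products `δ_b ⊗ δ_c` span `X ⊗ Y`; keep a maximal independent subfamily of the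
`u_l ⊗ v_l`, pad with standard products outside the current span until six independent products, Gram–Schmidt
their span (in `EuclideanSpace ℂ (P2 × P2)`, transported by currying). This is where the rank bound `6` of the
crux is consumed. Size M. -/
theorem stub_productFrame (u v : Fin 6 → (Fin 2 × Fin 2) → ℂ) :
    ∃ (u' v' : Fin 6 → (Fin 2 × Fin 2) → ℂ) (e : Fin 6 → (Fin 2 × Fin 2) → (Fin 2 × Fin 2) → ℂ),
      (∀ s t : Fin 6, (∑ b, ∑ c, conj (e s b c) * e t b c) = if s = t then 1 else 0) ∧
      (∀ s, e s ∈ Submodule.span ℂ (Set.range fun l : Fin 6 => fun b c => u' l b * v' l c)) ∧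
      ∀ l : Fin 6, (fun b c => u l b * v l c) ∈ Submodule.span ℂ (Set.range e) := by
  sorry

/-- **Stub 3 — the EASY regime (provable now; no products needed).** If the multiplied vectors
`m(e_s) : a ↦ Σ_μ e_s (a.1,μ) (μ,a.2)` of an orthonormal `k`-frame span at most `3` dimensions of `ℂ^{P2}`, then
`cap e ≤ 6`.
Why true: let `q_1, …, q_r` (`r ≤ 3`) be an orthonormal basis of `span {m(e_s)}` (`exists_orthonormalBasis` on the
finite-dimensional subspace of `EuclideanSpace ℂ (Fin 2 × Fin 2)`); then `‖m(e_s)‖² = Σ_j |⟨q_j, m(e_s)⟩|²` and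
`⟨q_j, m(e_s)⟩ = ⟨m* q_j, e_s⟩` with `(m* q)(b,c) = [b.2 = c.1] · q (b.1, c.2)`, `‖m* q‖² = 2‖q‖²`; Bessel for the
orthonormal family `e` (`Orthonormal.sum_inner_products_le`) gives `Σ_s |⟨m* q_j, e_s⟩|² ≤ 2`, hence
`cap e ≤ 2 r ≤ 6`. (In plane language: `cap = ‖m|_E‖²_HS ≤ ‖m‖²_op · rank = 2 · dim m(E)`, i.e.
`dim (E ∩ ker m) ≥ 3 ⇒ cap ≤ 6`.) Size M. -/
theorem stub_capEasyRegime {k : ℕ} (e : Fin k → (Fin 2 × Fin 2) → (Fin 2 × Fin 2) → ℂ)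
    (he : ∀ s t : Fin k, (∑ b, ∑ c, conj (e s b c) * e t b c) = if s = t then 1 else 0)
    (hdim : Module.finrank ℂ (Submodule.span ℂ (Set.range fun s : Fin k =>
        fun a : Fin 2 × Fin 2 => ∑ μ : Fin 2, e s (a.1, μ) (μ, a.2))) ≤ 3) :
    ∑ s, ∑ a : Fin 2 × Fin 2, ‖∑ m : Fin 2, e s (a.1, m) (m, a.2)‖ ^ 2 ≤ 6 := by
  sorry

/-- **Stub 4 — the HARD regime (the load-bearing stub; ⟺ the crux given stubs 1–3).** For an orthonormal
6-frame `e` inside an honest product span whose multiplied vectors `m(e_s)` span all of `ℂ^{P2}` (`dim = 4`,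
i.e. `E ∩ ker m` is exactly `2`-dimensional, `E = graph(L) ⊕ (E ∩ ker m)` with `L : W → ker m` linear,
`W = m*(ℂ^{P2})` the slice space of `⟨2,2,2⟩`): `cap e ≤ 7`, i.e. `Σ_i cos² θ_i(E, W) ≤ 7/2`, i.e.
`Σ_i s_i(L)² / (1 + s_i(L)²) ≥ 1/2`.
Why plausibly true: it is the crux on the comeagre regime (1030 descents, 160 exact-elimination ascents, cone
feasibility at 7.02 infeasible — never above 7; second stationary value 6.816); equality exactly on the stratum of
product 6-planes through the slice space of a maximiser `⟨2,2,2⟩ − t_{xyz}` (`s(L) = (0,0,0,1)`: three slices inside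
`E`, the fourth at `45°`), honest (Strassen-six, its stabiliser-torus family) and border (Bini-plus-one limits).
Known partial structure: `rank L ≥ 1` is `R(⟨2,2,2⟩) = 7`; on the stratum `rank L = 1` the claim is `‖L‖ ≥ 1`;
the single-witness strengthening `s_max(L) ≥ 1` is FALSE (isotropic planes, all `cos² ≈ 0.707`). Size XL. -/
theorem stub_capHardRegime (u v : Fin 6 → (Fin 2 × Fin 2) → ℂ)
    (e : Fin 6 → (Fin 2 × Fin 2) → (Fin 2 × Fin 2) → ℂ)
    (he : ∀ s t : Fin 6, (∑ b, ∑ c, conj (e s b c) * e t b c) = if s = t then 1 else 0)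
    (hps : ∀ s, e s ∈ Submodule.span ℂ (Set.range fun l : Fin 6 => fun b c => u l b * v l c))
    (hdim : 3 < Module.finrank ℂ (Submodule.span ℂ (Set.range fun s : Fin 6 =>
        fun a : Fin 2 × Fin 2 => ∑ μ : Fin 2, e s (a.1, μ) (μ, a.2)))) :
    ∑ s, ∑ a : Fin 2 × Fin 2, ‖∑ m : Fin 2, e s (a.1, m) (m, a.2)‖ ^ 2 ≤ 7 := by
  sorry

/-! ## The composition (kernel-checked, no `sorry` of its own) -/

/-- The output slices of a sum of triads lie in the span of any frame containing the products. -/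
theorem slice_mem_span {k : ℕ} (e : Fin k → P2 → P2 → ℂ) (w u v : Fin 6 → P2 → ℂ)
    (hprod : ∀ l : Fin 6, prodVec (u l) (v l) ∈ Submodule.span ℂ (Set.range e)) (a : P2) :
    (∑ i, triad (w i) (u i) (v i)) a ∈ Submodule.span ℂ (Set.range e) := by
  have hslice : (∑ i, triad (w i) (u i) (v i)) a = ∑ i, w i a • prodVec (u i) (v i) := by
    funext b c
    simp [Finset.sum_apply, triad_apply, prodVec, Pi.smul_apply, smul_eq_mul, mul_assoc]
  rw [hslice]
  exact Submodule.sum_mem _ fun i _ => Submodule.smul_mem _ _ (hprod i)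

/-- **Capture bound from stubs 3–4**: every honest product 6-frame has `cap e ≤ 7` — `≤ 6` when the multiplied
vectors span `≤ 3` dimensions, `≤ 7` by the hard-regime stub otherwise. -/
theorem cap_le_seven (u v : Fin 6 → P2 → ℂ) (e : Fin 6 → P2 → P2 → ℂ) (he : IsONFrame e)
    (hps : IsProductSpanned u v e) : cap e ≤ 7 := by
  by_cases hdim : Module.finrank ℂ (Submodule.span ℂ (Set.range fun s : Fin 6 =>
      fun a : Fin 2 × Fin 2 => ∑ μ : Fin 2, e s (a.1, μ) (μ, a.2))) ≤ 3
  · have h6 := stub_capEasyRegime e he hdim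
    show (∑ s, ∑ a : P2, ‖∑ m : Fin 2, e s (a.1, m) (m, a.2)‖ ^ 2) ≤ 7
    linarith
  · exact stub_capHardRegime u v e he hps (not_le.mp hdim)

/-- **`SevenEighthsLaw` from the four stubs.** A rank-`≤ 6` tensor `S` is a sum of six triads
(`exists_eq_sum_triad_of_tensorRank_le`); its six products lie in an honest product-spanned 6-plane with
orthonormal basis `e` (stub 2); `cap e ≤ 7` (stubs 3–4, `cap_le_seven`); the output slices of `S` lie in
`span e`, so slice elimination (stub 1) gives `|⟨S,T⟩|² ≤ ‖S‖² · cap e ≤ 7‖S‖²`. -/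
theorem SevenEighthsLaw_of : SevenEighthsLaw := by
  intro S hS
  obtain ⟨w, u, v, hdec⟩ := exists_eq_sum_triad_of_tensorRank_le hS
  obtain ⟨u', v', e, he, hps, hprod⟩ := stub_productFrame u v
  have hcap : cap e ≤ 7 := cap_le_seven u' v' e he hps
  have hslices : ∀ a : P2, S a ∈ Submodule.span ℂ (Set.range e) := by
    intro a
    rw [hdec]
    exact slice_mem_span e w u v hprod a
  have h1 := stub_sliceElimination e he S hslices
  have hnn : (0 : ℝ) ≤ ∑ a, ∑ b, ∑ c, ‖S a b c‖ ^ 2 := by positivity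
  calc ‖∑ a, ∑ b, ∑ c, S a b c * matMulTensor ℂ 2 2 2 a b c‖ ^ 2
      ≤ (∑ a, ∑ b, ∑ c, ‖S a b c‖ ^ 2) * cap e := h1
    _ ≤ (∑ a, ∑ b, ∑ c, ‖S a b c‖ ^ 2) * 7 := mul_le_mul_of_nonneg_left hcap hnn
    _ = 7 * ∑ a, ∑ b, ∑ c, ‖S a b c‖ ^ 2 := by ring

end Summit.MatrixMultiplication.MatrixMultiplication.Cruxes.SevenEighthsLaw.SingletFractionTransfer

end
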